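import Mathlib
import HarnessLib
import Summits.QuantumAdvantage.QuantumAdvantage.Theorems.PairFreezing
import Summits.QuantumAdvantage.QuantumAdvantage.Theses.PolyFeatureDial

/-!
# Parity pinning — the RELATIVE form of pair freezing (lens-4 gen 5, cell decomp-qadv)

LANDS AFTER `Theorems/PairFreezing.lean` (= lens-4 g4 `PairFreezingTheorems.v3.lean`, LAND-FIRST list) and extends its
namespace.  Contents (all sorry-free; see the node card HOME/decomp-qadv-lens-4/g5/NODE-g5.md):
* §10 `IsLiteralMap`, `Balanced g M`, the game-free law `RelSmolensky p`; degree under literal maps; the class lemmas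
  `Pairing.class_bound_rel / core_rel / core_quarter`, `denseLose_rel`, `balBudget`;
* §11 `WalkHardFFeatBal p` and `walkHardFFeatBal_holds` — the POLYLOG feature rung for parity-balanced feature maps (p ≠ 3);
* §12 the node: `BalancedRungOdd` (PROVED) ∧ `PinningRungOdd` (residual) ⟺ `PolyFeatureDial.FeatureRungPolyOdd` (28532),
  `RelSmolOdd → PinningRungOdd`, `polyPiecesGlue_holds : PolyFeatureDial.PolyPiecesGlue` (item 28534 BY NAME),
  `closes_of_pinning / closes_of_relSmol : … → AdviceFreeQNC0Odd` through the tree's `PolyFeatureDial.closes`;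
* §13 `DependsOn`, `balanced_of_dependsOn`, `WalkHardLocal` + `walkHardLocal_holds` (strategies reading ≤ (log₂ n)^A
  input bits lose; unconditional).
Filing (prover lane): `--supports stmt-QuantumAdvantage-28532 --supports …-28534` (28534 closable by `polyPiecesGlue_holds`).
-/

set_option linter.dupNamespace false -- D-0017: single-problem summit ⇒ `QuantumAdvantage.QuantumAdvantage` by design

namespace Summit.QuantumAdvantage.QuantumAdvantage.Theorems.PairFreezing

open Classical Finset Summit.QuantumAdvantage.AdviceFreeQNC0
open Literature.Computability.MetaComplexity Literature.Computability.MetaComplexity.Smolensky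
open Literature.Computability.Complexity (parityFn)
open Summit.QuantumAdvantage.QuantumAdvantage.Theses

variable {n : ℕ}

/-! ## GEN 5 (lens 4 «minimal-counterexample / extremal reduction», seat decomp-qadv-lens-4-g5) — PARITY PINNING

### §10 The RELATIVE form of pair freezing: `Balanced` level sets and the game-free law `RelSmolensky p`

WHERE `K` ENTERS (g4 NEXT-g5 §1–§4): the ONLY exponential cost of the feature-count dial is the ABSOLUTE error
`D·C(m,m/2) ≈ (D/√M)·2^m` of Smolensky's bound in `class_bound`, paid once per feature CELL (`2^K` cells) —
the occupation term already decays like `2^{-E}` at a threshold cost linear in `E`.  The extremal question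
underneath is therefore GAME-FREE:

> how strongly can the parity of `m` free bits correlate with a SPARSE set `U ⊆ {0,1}^m` cut out by an
> `𝔽_p`-polynomial of degree `d`, RELATIVE TO `#U`?

`Balanced g M` (below) says: on every LITERAL sub-cube of dimension `m ≥ M` (each ambient coordinate a constant
or a literal `b ⊕ z_k` — exactly the shape of a pair-freezing class, `e_fst`/`e_snd`/`e_of_not_free`) the
level set `{g = true}` meets the two parity classes in ratio at most `3 : 1` (relative bias `≤ ½`).
`RelSmolensky p` says every `𝔽_p`-degree-`d` Boolean function on `m ≥ A·(d+1)²` bits is so balanced.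
Conjectured extremisers (lens output, census KIT ASK «RELATIVE-SMOLENSKY EXTREMISER HUNT» 2026-08-30T05:47Z,
PREDICTION-AMENDMENT 06:01Z): BLOCK-SYMMETRIC indicators — disjoint blocks carrying (shifted) residue readers
`[|z_B ⊕ s| ≡ r (mod p^j)]`, `p^j ≤ d+1` (degree `p^j − 1` each), times pinned literals, every coordinate used;
the relative bias MULTIPLIES over blocks, a reader on `m′` bits contributing
`|Σ_{k≡r}(−1)^k C(m′,k)| / Σ_{k≡r} C(m′,k) ≈ 2p^j·exp(−π²m′/8p^{2j})`.  The largest modulus `q = p^j ≤ d+1` sets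
the decay scale (threshold `m′ ≈ 1.12·q²` for ratio `3 : 1`, plus `≤ 2d` pinned / small-block coordinates), so
the exponent `2` in `(d+1)²` is SHARP on this family and `A = 2` is the predicted constant.

With `Balanced` in place of `HasDegF` the whole dense side of pair freezing goes through WITH NO DEGREE
HYPOTHESIS AND NO `2^K`: `class_bound_rel` → `core_rel` → `denseLose_rel` (`¼·#U ≤ #(U∖WIN) + (3/2)·2^{-E}·2^L`
for tables firing `≥ 24(M+E)+8` cuts) → the routing theorem `walkHardFFeatBal_holds` (§11) for POLYLOG-many
features.  §12 is the node. -/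

section Rel

variable {n : ℕ}

/-- a LITERAL MAP `E : {0,1}^m → {0,1}^n`: every ambient coordinate is a constant `b` or a literal `b ⊕ z_k`. -/
def IsLiteralMap {m n : ℕ} (E : (Fin m → Bool) → (Fin n → Bool)) : Prop :=
  ∀ j : Fin n, ∃ b : Bool, (∀ z, E z j = b) ∨ ∃ k : Fin m, ∀ z, E z j = xor b (z k)

/-- **`Balanced g M`** — the level set `{g = true}` is PARITY-BALANCED at scale `M`: on every literal sub-cube of
dimension `m ≥ M` its odd-parity and even-parity parts are within a factor `3` of each other (relative parity
bias `≤ ½`).  Game-free; no degree. -/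
def Balanced (g : (Fin n → Bool) → Bool) (M : ℕ) : Prop :=
  ∀ m : ℕ, M ≤ m → ∀ E : (Fin m → Bool) → (Fin n → Bool), IsLiteralMap E →
    (univ.filter fun z : Fin m → Bool => g (E z) = true ∧ parityFn m z = true).card ≤
        3 * (univ.filter fun z : Fin m → Bool => g (E z) = true ∧ parityFn m z = false).card ∧
    (univ.filter fun z : Fin m → Bool => g (E z) = true ∧ parityFn m z = false).card ≤
        3 * (univ.filter fun z : Fin m → Bool => g (E z) = true ∧ parityFn m z = true).card

/-- **`RelSmolensky p` — RELATIVE SMOLENSKY (conjecture; game-free law; UNDECIDED).**  There is a constant `A` such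
that every Boolean function of `𝔽_p`-degree `≤ d` on `m ≥ A·(d+1)²` bits has relative parity bias `≤ ½`:
`#(U ∩ ODD) ≤ 3·#(U ∩ EVEN)` and symmetrically, `U = {f = true}`.  (Smolensky: `|#(U∩ODD) − #(U∩EVEN)| ≤ d·C(m,m/2)`,
absolute — vacuous for `#U < d·C(m,m/2)`.)  Test of record: the census extremiser hunt (small `m`, ILP). -/
def RelSmolensky (p : ℕ) [Fact p.Prime] : Prop :=
  ∃ A : ℕ, ∀ m d : ℕ, A * (d + 1) ^ 2 ≤ m → ∀ f : (Fin m → Bool) → Bool, HasDegF p f d →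
    (univ.filter fun z : Fin m → Bool => f z = true ∧ parityFn m z = true).card ≤
        3 * (univ.filter fun z : Fin m → Bool => f z = true ∧ parityFn m z = false).card ∧
    (univ.filter fun z : Fin m → Bool => f z = true ∧ parityFn m z = false).card ≤
        3 * (univ.filter fun z : Fin m → Bool => f z = true ∧ parityFn m z = true).card

/-- literal maps preserve `𝔽_p`-degree (each coordinate has degree `≤ 1`; `comp_mem_lowDeg_of_coord`). -/
theorem hasDegF_comp_literal {p : ℕ} [Fact p.Prime] {m d : ℕ} {g : (Fin n → Bool) → Bool} (hg : HasDegF p g d)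
    {E : (Fin m → Bool) → (Fin n → Bool)} (hE : IsLiteralMap E) : HasDegF p (fun z => g (E z)) d := by
  have hcoord : ∀ j : Fin n,
      (fun z : Fin m → Bool => if E z j = true then (1 : ZMod p) else 0) ∈ lowDeg (ZMod p) m 1 := by
    intro j
    obtain ⟨b, hb⟩ := hE j
    rcases hb with hconst | ⟨k, hk⟩
    · cases b
      · have : (fun z : Fin m → Bool => if E z j = true then (1 : ZMod p) else 0) = 0 := by
          funext z; rw [hconst z]; simp
        rw [this]; exact (lowDeg (ZMod p) m 1).zero_mem
      · have : (fun z : Fin m → Bool => if E z j = true then (1 : ZMod p) else 0) = 1 := by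
          funext z; rw [hconst z]; simp
        rw [this]; exact one_mem_lowDeg 1
    · have hmono : mono (ZMod p) ({k} : Finset (Fin m)) = fun z => if z k = true then (1 : ZMod p) else 0 := by
        funext z; unfold mono; rw [prod_singleton]
      cases b
      · have : (fun z : Fin m → Bool => if E z j = true then (1 : ZMod p) else 0) = mono (ZMod p) {k} := by
          rw [hmono]; funext z; rw [hk z, Bool.false_xor]
        rw [this]
        exact mono_mem_lowDeg (by rw [card_singleton])
      · have : (fun z : Fin m → Bool => if E z j = true then (1 : ZMod p) else 0) = 1 - mono (ZMod p) {k} := by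
          rw [hmono]; funext z; rw [hk z, Bool.true_xor]
          simp only [Pi.sub_apply, Pi.one_apply]
          cases z k <;> simp
        rw [this]
        exact (lowDeg (ZMod p) m 1).sub_mem (one_mem_lowDeg 1) (mono_mem_lowDeg (by rw [card_singleton]))
  exact Smolensky.comp_mem_lowDeg_of_coord E hcoord hg

/-- **edge LAW ⇒ BALANCE**: under `RelSmolensky p` (constant `A`), every degree-`d` level set is balanced at every
scale `M ≥ A·(d+1)²`. -/
theorem balanced_of_relSmolensky {p : ℕ} [Fact p.Prime] {A : ℕ}
    (hA : ∀ m d : ℕ, A * (d + 1) ^ 2 ≤ m → ∀ f : (Fin m → Bool) → Bool, HasDegF p f d →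
      (univ.filter fun z : Fin m → Bool => f z = true ∧ parityFn m z = true).card ≤
          3 * (univ.filter fun z : Fin m → Bool => f z = true ∧ parityFn m z = false).card ∧
      (univ.filter fun z : Fin m → Bool => f z = true ∧ parityFn m z = false).card ≤
          3 * (univ.filter fun z : Fin m → Bool => f z = true ∧ parityFn m z = true).card)
    {d M : ℕ} (hM : A * (d + 1) ^ 2 ≤ M) {g : (Fin n → Bool) → Bool} (hg : HasDegF p g d) : Balanced g M :=
  fun m hm E hE => hA m d (hM.trans hm) (fun z => g (E z)) (hasDegF_comp_literal hg hE)

namespace Pairing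

variable (π : Pairing n) (c : ℕ) (tab : Fin (n + 1) → Bool)

/-- the class parametrisation `e_r` is a literal map. -/
theorem e_isLiteralMap (r : Fin n → Bool) : IsLiteralMap (π.e c tab r) := by
  intro j
  by_cases hfree : ∃ k, j = π.fst (π.emb c tab r k) ∨ j = π.snd (π.emb c tab r k)
  · obtain ⟨k, hk⟩ := hfree
    refine ⟨r j, Or.inr ⟨k, fun z => ?_⟩⟩
    rcases hk with rfl | rfl
    · exact π.e_fst c tab r z k
    · exact π.e_snd c tab r z k
  · push Not at hfree
    exact ⟨r j, Or.inl fun z => π.e_of_not_free c tab r z j fun k => hfree k⟩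

/-- **per-class RELATIVE bound.**  On a class with `m ≥ M` free bits, a level set balanced at scale `M` meets the
winning inputs at most `3×` as often as the losing ones (the win bit is `W(r) ⊕ PARITY`, `ringWinU_e`).  No degree,
no `C(m,m/2)`. -/
theorem class_bound_rel {g : (Fin n → Bool) → Bool} {M : ℕ} (hg : Balanced g M) (r : Fin n → Bool)
    (hm : M ≤ π.m c tab r) :
    (univ.filter fun z => (g (π.e c tab r z) && ringWinU c (fun h _ => tab h) (π.e c tab r z)) = true).card ≤
      3 * (univ.filter fun z => (g (π.e c tab r z) && !ringWinU c (fun h _ => tab h) (π.e c tab r z)) = true).card := by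
  set W : (Fin n → Bool) → Bool := ringWinU c (fun h _ => tab h) with hWdef
  set E := π.e c tab r with hE
  obtain ⟨h1, h2⟩ := hg _ hm E (π.e_isLiteralMap c tab r)
  have hW : ∀ z, W (E z) = xor (W r) (parityFn (π.m c tab r) z) := π.ringWinU_e c tab r
  have hX : ∀ b : Bool, (univ.filter fun z : Fin (π.m c tab r) → Bool => (g (E z) && W (E z)) = b ∧ g (E z) = true) =
      univ.filter fun z => g (E z) = true ∧ parityFn (π.m c tab r) z = xor (W r) b := by
    intro b
    refine Finset.filter_congr fun z _ => ?_
    rw [hW z]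
    cases g (E z) <;> cases W r <;> cases parityFn (π.m c tab r) z <;> cases b <;> simp
  have hA : (univ.filter fun z : Fin (π.m c tab r) → Bool => (g (E z) && W (E z)) = true) =
      univ.filter fun z => (g (E z) && W (E z)) = true ∧ g (E z) = true := by
    refine Finset.filter_congr fun z _ => ?_
    cases g (E z) <;> simp
  have hB : (univ.filter fun z : Fin (π.m c tab r) → Bool => (g (E z) && !W (E z)) = true) =
      univ.filter fun z => (g (E z) && W (E z)) = false ∧ g (E z) = true := by
    refine Finset.filter_congr fun z _ => ?_
    cases g (E z) <;> cases W (E z) <;> simp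
  rw [hA, hB, hX true, hX false]
  cases hb : W r
  · simpa using h1
  · simpa using h2

/-- **THE RELATIVE CORE INEQUALITY.**  For every fixed table, pairing and level set `U = {g = true}` balanced at
scale `M`:  `#(U ∩ WIN) ≤ 3·#(U ∖ WIN) + #{u : fewer than M relevant free pairs}` — in `ℕ`, no `2ⁿ`-sized error. -/
theorem core_rel {g : (Fin n → Bool) → Bool} {M : ℕ} (hg : Balanced g M) :
    (univ.filter fun u => (g u && ringWinU c (fun h _ => tab h) u) = true).card ≤
      3 * (univ.filter fun u => (g u && !ringWinU c (fun h _ => tab h) u) = true).card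
        + (univ.filter fun u => decide ((π.rel c tab u).card < M) = true).card := by
  set W : (Fin n → Bool) → Bool := ringWinU c (fun h _ => tab h) with hWdef
  set Reps := (univ : Finset (Fin n → Bool)).image (π.rep c tab) with hReps
  have hRep : ∀ r ∈ Reps, π.rep c tab r = r := by
    intro r hr
    rw [hReps, mem_image] at hr
    obtain ⟨u, _, rfl⟩ := hr
    exact π.rep_rep c tab u
  have fib : ∀ A : (Fin n → Bool) → Bool, (univ.filter fun u => A u = true).card =
      ∑ r ∈ Reps, (univ.filter fun u => A u = true ∧ π.rep c tab u = r).card := by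
    intro A
    rw [card_eq_sum_card_fiberwise (f := π.rep c tab) (t := Reps)
      (fun u _ => mem_image_of_mem _ (mem_univ u))]
    refine sum_congr rfl fun r _ => ?_
    rw [filter_filter]
  have hcls : ∀ r ∈ Reps,
      (univ.filter fun u => (g u && W u) = true ∧ π.rep c tab u = r).card ≤
        3 * (univ.filter fun u => (g u && !W u) = true ∧ π.rep c tab u = r).card
        + (univ.filter fun u => decide ((π.rel c tab u).card < M) = true ∧ π.rep c tab u = r).card := by
    intro r hr
    have hr' := hRep r hr
    by_cases hbig : M ≤ π.m c tab r
    · rw [π.card_filter_class c tab hr' (fun u => g u && W u),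
        π.card_filter_class c tab hr' (fun u => g u && !W u)]
      exact (π.class_bound_rel c tab hg r hbig).trans (Nat.le_add_right _ _)
    · rw [not_le] at hbig
      have hsub : (univ.filter fun u => (g u && W u) = true ∧ π.rep c tab u = r) ⊆
          (univ.filter fun u => decide ((π.rel c tab u).card < M) = true ∧ π.rep c tab u = r) := by
        intro u hu
        rw [mem_filter] at hu ⊢
        refine ⟨mem_univ _, ?_, hu.2.2⟩
        have : π.rel c tab u = π.rel c tab r := by rw [← hu.2.2, rel_rep]
        rw [this, decide_eq_true_eq]; exact hbig
      exact (card_le_card hsub).trans (Nat.le_add_left _ _)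
  rw [fib (fun u => g u && W u), fib (fun u => g u && !W u),
    fib (fun u => decide ((π.rel c tab u).card < M)), mul_sum, ← sum_add_distrib]
  exact sum_le_sum hcls

/-- the relative core inequality in the form used downstream: `4·#(U ∩ WIN) ≤ 3·#U + #{#Rel < M}`. -/
theorem core_quarter {g : (Fin n → Bool) → Bool} {M : ℕ} (hg : Balanced g M) :
    4 * (univ.filter fun u => (g u && ringWinU c (fun h _ => tab h) u) = true).card ≤
      3 * (univ.filter fun u => g u = true).card
        + (univ.filter fun u => decide ((π.rel c tab u).card < M) = true).card := by
  have h := π.core_rel c tab hg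
  have hsplit : (univ.filter fun u => g u = true).card =
      (univ.filter fun u => (g u && ringWinU c (fun h _ => tab h) u) = true).card
      + (univ.filter fun u => (g u && !ringWinU c (fun h _ => tab h) u) = true).card := by
    rw [← card_union_of_disjoint]
    · refine congrArg Finset.card ?_
      ext u
      simp only [mem_union, mem_filter, mem_univ, true_and]
      cases g u <;> cases ringWinU c (fun h _ => tab h) u <;> simp
    · refine disjoint_filter.2 fun u _ h1 h2 => ?_
      revert h1 h2
      cases g u <;> cases ringWinU c (fun h _ => tab h) u <;> simp
  omega

end Pairing

/-- **relative dense law** (no degree, no `√M`): inside any level set `U` balanced at scale `M`, every fixed table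
with at least `24(M+E)+8` fired cuts loses on at least `¼·#U − (3/2)·2^{-E}·2^L` inputs. -/
theorem denseLose_rel {L : ℕ} (hL1 : 1 ≤ L) (c : ℕ) (tab : Fin (L + 1) → Bool) (g : (Fin L → Bool) → Bool)
    {M E : ℕ} (hg : Balanced g M)
    (hS : 24 * (M + E) + 8 ≤ (univ.filter fun h : Fin (L + 1) => tab h = true).card) :
    (1 / 4 : ℝ) * ((univ.filter fun z : Fin L → Bool => g z = true).card : ℝ) ≤
      ((univ.filter fun z : Fin L → Bool => g z = true ∧ ringWinU c (fun h _ => tab h) z = false).card : ℝ)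
        + ((3 / 2) / 2 ^ E) * (2 : ℝ) ^ L := by
  obtain ⟨π, hπ⟩ : ∃ π : Pairing L, (univ.filter fun h : Fin (L + 1) => tab h = true).card ≤ 2 + 2 * π.t tab := by
    have hcov := card_fired_le_two_add L hL1 tab
    by_cases h01 : (pairing1 L hL1).t tab ≤ (pairing0 L).t tab
    · exact ⟨pairing0 L, by omega⟩
    · exact ⟨pairing1 L hL1, by omega⟩
  have hK : 6 * (M + E) ≤ π.K tab := by
    unfold Pairing.K; omega
  have hcore := π.core_quarter c tab hg
  have hocc := π.occupation_real tab c M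
  have h2L : (0 : ℝ) < (2 : ℝ) ^ L := by positivity
  have herr2 : 3 * 2 ^ M * (7 / 8 : ℝ) ^ π.K tab ≤ 3 / 2 ^ E := by
    have h78 : (7 / 8 : ℝ) ^ π.K tab ≤ (7 / 8 : ℝ) ^ (6 * (M + E)) :=
      pow_le_pow_of_le_one (by norm_num) (by norm_num) hK
    have h6 : (7 / 8 : ℝ) ^ (6 * (M + E)) ≤ (1 / 2 : ℝ) ^ (M + E) := by
      rw [pow_mul]
      exact pow_le_pow_left₀ (by norm_num) (by norm_num) _
    have hhalf : (3 : ℝ) * 2 ^ M * (1 / 2 : ℝ) ^ (M + E) = 3 / 2 ^ E := by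
      rw [pow_add, one_div_pow, one_div_pow]
      field_simp
    have h2M : (0 : ℝ) ≤ 3 * 2 ^ M := by positivity
    calc 3 * 2 ^ M * (7 / 8 : ℝ) ^ π.K tab ≤ 3 * 2 ^ M * (1 / 2 : ℝ) ^ (M + E) :=
          mul_le_mul_of_nonneg_left (h78.trans h6) h2M
      _ = 3 / 2 ^ E := hhalf
  have hsplit : ((univ.filter fun z : Fin L → Bool => g z = true).card : ℝ) =
      (univ.filter fun z : Fin L → Bool => (g z && ringWinU c (fun h _ => tab h) z) = true).card
      + (univ.filter fun z : Fin L → Bool => g z = true ∧ ringWinU c (fun h _ => tab h) z = false).card := by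
    rw [← Nat.cast_add, ← card_union_of_disjoint]
    · refine congrArg _ (congrArg Finset.card ?_)
      ext u
      simp only [mem_union, mem_filter, mem_univ, true_and]
      cases g u <;> cases ringWinU c (fun h _ => tab h) u <;> simp
    · refine disjoint_filter.2 fun u _ h1 h3 => ?_
      revert h1 h3
      cases g u <;> cases ringWinU c (fun h _ => tab h) u <;> simp
  have hcoreR : (4 : ℝ) * ((univ.filter fun z : Fin L → Bool =>
      (g z && ringWinU c (fun h _ => tab h) z) = true).card : ℝ) ≤
      3 * ((univ.filter fun z : Fin L → Bool => g z = true).card : ℝ)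
        + ((univ.filter fun u : Fin L → Bool => decide ((π.rel c tab u).card < M) = true).card : ℝ) := by
    exact_mod_cast hcore
  have hB : ((univ.filter fun u : Fin L → Bool => decide ((π.rel c tab u).card < M) = true).card : ℝ) ≤
      (3 / 2 ^ E) * 2 ^ L := hocc.trans (mul_le_mul_of_nonneg_right herr2 h2L.le)
  have hexp : ((3 / 2 : ℝ) / 2 ^ E) * (2 : ℝ) ^ L = (1 / 2) * ((3 / 2 ^ E) * 2 ^ L) := by ring
  rw [hexp]
  linarith

/-- sparse budget of the polylog routing: `T³·(log₂ n)^{2(C+C')+2} ≤ n` for `T = 24(M+E)+7`,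
`M = (log₂ n)^A`, `E = K + E₀`, `K ≤ (log₂ n)^{C'}`. -/
theorem balBudget {A C C' E₀ N₁ n K M E T : ℕ}
    (hN₁ : ∀ N ≥ N₁, (55 + 24 * E₀) ^ 3 * Nat.log 2 N ^ (3 * (A + C') + (2 * (C + C') + 2)) ≤ N)
    (hN : N₁ ≤ n) (hℓ : 1 ≤ Nat.log 2 n) (hK : K ≤ Nat.log 2 n ^ C')
    (hMdef : M = Nat.log 2 n ^ A) (hEdef : E = K + E₀) (hTdef : T = 24 * (M + E) + 7) :
    T ^ 3 * Nat.log 2 n ^ (2 * (C + C') + 2) ≤ n := by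
  set ℓ := Nat.log 2 n with hℓdef
  have hpow : ∀ a b : ℕ, a ≤ b → ℓ ^ a ≤ ℓ ^ b := fun a b hab => Nat.pow_le_pow_right hℓ hab
  have h1 : 1 ≤ ℓ ^ (A + C') := Nat.one_le_pow _ _ hℓ
  have hM : M ≤ ℓ ^ (A + C') := by rw [hMdef]; exact hpow _ _ (Nat.le_add_right _ _)
  have hKle : K ≤ ℓ ^ (A + C') := hK.trans (hpow _ _ (Nat.le_add_left _ _))
  have hT : T ≤ (55 + 24 * E₀) * ℓ ^ (A + C') := by
    rw [hTdef, hEdef]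
    nlinarith
  calc T ^ 3 * ℓ ^ (2 * (C + C') + 2)
      ≤ ((55 + 24 * E₀) * ℓ ^ (A + C')) ^ 3 * ℓ ^ (2 * (C + C') + 2) :=
        Nat.mul_le_mul_right _ (Nat.pow_le_pow_left hT 3)
    _ = (55 + 24 * E₀) ^ 3 * ℓ ^ (3 * (A + C') + (2 * (C + C') + 2)) := by ring
    _ ≤ n := hN₁ n hN

/-- **`WalkHardFFeatBal p`** — the POLYLOG feature rung for BALANCED feature maps: feature strategies
`y_g(u) = tab_g(f₁(u),…,f_K(u))` with `K ≤ (log₂ n)^{C'}` features of `𝔽_p`-degree `(log₂ n)^C`, all of whose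
`2^K` cells `{f⃗ = v}` are parity-balanced at scale `(log₂ n)^A`, win α's u-walk game on at most `θ·2ⁿ` inputs —
ONE `θ < 1` for all `C, C', A`. -/
def WalkHardFFeatBal (p : ℕ) [Fact p.Prime] : Prop :=
  ∃ θ : ℝ, θ < 1 ∧ ∀ C C' A : ℕ, ∃ n₀ : ℕ, ∀ n ≥ n₀, ∀ K ≤ (Nat.log 2 n) ^ C', ∀ c : ℕ,
    ∀ f : Fin K → (Fin n → Bool) → Bool, ∀ tab : Fin (n + 1) → (Fin K → Bool) → Bool,
    (∀ j, HasDegF p (f j) ((Nat.log 2 n) ^ C)) →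
    (∀ v : Fin K → Bool, Balanced (fun u => decide ((fun j => f j u) = v)) ((Nat.log 2 n) ^ A)) →
      ((univ.filter fun u : Fin n → Bool =>
          ringWinU c (fun g u => tab g (fun j => f j u)) u = true).card : ℝ) ≤ θ * (2 : ℝ) ^ n


end Rel
end Summit.QuantumAdvantage.QuantumAdvantage.Theorems.PairFreezing
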